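import Literature.AnabelianGeometry.SemiGraphs.PSCVertCountConnectivity
import HarnessLib

/-!
# [CombGC] Rmk. 1.1.3 `i(G_U) ≤ n(G_U) + 1` for ARBITRARY dual graphs: representatives along a spanning tree plus stable letters

Mochizuki, *A combinatorial version of the Grothendieck conjecture* [CombGC] §1, Def. 1.1 (i)(ii) p. 6
("for each vertex `v` … a subgroup `Π_v ≤ Π_G` determined up to conjugation"; each branch of a node `e`
gives an inclusion of a CONJUGATE of `Π_e` into the verticial group of its end), Rmk. 1.1.3 p. 8
[cite: MochizukiCombGC2007, Rmk 1.1.3 p.8]; [IUTchI] Rmk. 1.2.3 (i) p. 41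
[cite: Mochizuki2012, IUTchI Rmk 1.2.3(i) p.41].

Sequel of `PSCVertCountConnectivity.lean` (abc-iut-w4-d052).  There the sub-node row F-3810
`PSCDatum.VertCountLeNodeCountSucc` (`i(G_U) ≤ n(G_U) + 1` for every open `U`) was derived for data
whose representatives are TREE-ALIGNED (`Π_e ≤ Π_{src e} ⊓ Π_{tgt e}`) — the shape Def. 1.1 extracts
from the graph of profinite groups of a pointed stable curve whose dual graph is a TREE.  For an
ARBITRARY (connected) dual graph one aligns the representatives along a spanning tree only; every other
node `e` comes with a STABLE LETTER `t_e ∈ Π_G` (the `γ` of Def. 1.1 (ii), `PSCDatum.nodeGp_le`):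
`Π_e ≤ Π_{src e}` and `t_e Π_e t_e⁻¹ ≤ Π_{tgt e}`, and `Π_G` is topologically generated by the `Π_v`
TOGETHER WITH the `t_e` (fundamental group of a graph of groups = vertex groups and stable letters).
This PROOF-ONLY file (no definitions) proves the criterion in that generality:

* `eqvGen_doubleCoset_of_generate_stable` — the coset graph `𝒯_U` of every covering (`U` open), with
  vertices `⊔_v U\Π/Π_v` and the node `UgΠ_e` joining `UgΠ_{src e}` to `U g t_e⁻¹ Π_{tgt e}`, is
  CONNECTED, provided the vertex set is connected along the nodes with `t_e = 1` and
  `⟨⋃_v Π_v, (t_e)_e⟩` is dense: the set of `g` all of whose vertices lie in the base component contains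
  `1`, is stable under right multiplication by every `Π_w` and by every `t_e^{±1}` (the node `UgΠ_e`,
  resp. `Ugt_eΠ_e`, has one end already in the component), and every coset `Ug` meets the dense
  subgroup.
* `vertCountLeNodeCountSucc_of_generate_stable` — hence `G.VertCountLeNodeCountSucc` (compact `Π`); the
  tree-aligned criterion `vertCountLeNodeCountSucc_of_generate` is the case `t ≡ 1`.
* `vertCountLeNodeCountSucc_of_oneVertex_stable` — ONE-VERTEX data with self-nodes (irreducible nodal
  curves: `Π_v ≠ Π_G` in general, `i(G_U) > 1` for coverings; outside the `Π_v = Π` lemma of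
  abc-iut-w5-d195): `Π_e ≤ Π_v`, `t_e Π_e t_e⁻¹ ≤ Π_v`, `⟨Π_v, (t_e)⟩` dense ⇒ `i(G_U) ≤ n(G_U) + 1`.

Group theory over the interface (Bass–Serre without trees); instance / consistency evidence for the typed
schema; nothing here takes a side on [IUTchIII] Cor. 3.12.
-/

noncomputable section

namespace Literature.AnabelianGeometry.SemiGraphs

universe u

namespace PSCDatum

open scoped Pointwise

variable {P : Type u} [Group P] [TopologicalSpace P] [IsTopologicalGroup P]

/-! ### The coset graphs with stable letters are connected -/

/-- **The coset graph of a covering is connected (stable letters).**  Nodes oriented by `src, tgt`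
with stable letters `t : N → Π`; the vertex set connected along the nodes with `t e = 1`; the vertex
groups together with the stable letters topologically generate `Π`.  Then for every open `U ≤ Π` any
two vertices `UgΠ_v`, `Ug'Π_{v'}` of `G_U` are joined by a chain of nodes `UhΠ_e` (joining `UhΠ_{src e}`
to `U h t_e⁻¹ Π_{tgt e}`). [cite: MochizukiCombGC2007, Rmk 1.1.3 p.8] -/
theorem eqvGen_doubleCoset_of_generate_stable (G : PSCDatum P) (src tgt : G.graph.N → G.graph.V)
    (t : G.graph.N → P)
    (hconn : ∀ v w : G.graph.V,
      Relation.EqvGen (fun a b => ∃ e, t e = 1 ∧ src e = a ∧ tgt e = b) v w)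
    (hgen : ((⨆ v, G.vertGp v) ⊔ Subgroup.closure (Set.range t)).topologicalClosure = ⊤)
    (U : Subgroup P) (hU : IsOpen (U : Set P)) :
    ∀ x y : (Σ v : G.graph.V, DoubleCoset.Quotient (U : Set P) (G.vertGp v : Set P)),
      Relation.EqvGen (fun a b => ∃ (e : G.graph.N) (g : P),
        a = ⟨src e, DoubleCoset.mk U (G.vertGp (src e)) g⟩ ∧
          b = ⟨tgt e, DoubleCoset.mk U (G.vertGp (tgt e)) (g * (t e)⁻¹)⟩) x y := by
  classical
  -- the vertices `UgΠ_v`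
  let ρ : P → G.graph.V → (Σ v : G.graph.V, DoubleCoset.Quotient (U : Set P) (G.vertGp v : Set P)) :=
    fun g v => ⟨v, DoubleCoset.mk U (G.vertGp v) g⟩
  -- abbreviation for the adjacency relation
  set R : (Σ v : G.graph.V, DoubleCoset.Quotient (U : Set P) (G.vertGp v : Set P)) →
      (Σ v : G.graph.V, DoubleCoset.Quotient (U : Set P) (G.vertGp v : Set P)) → Prop :=
    fun a b => ∃ (e : G.graph.N) (g : P),
      a = ⟨src e, DoubleCoset.mk U (G.vertGp (src e)) g⟩ ∧
        b = ⟨tgt e, DoubleCoset.mk U (G.vertGp (tgt e)) (g * (t e)⁻¹)⟩ with hR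
  -- (1) the tree chain translated by `g`: `UgΠ_v ~ UgΠ_w`
  have step1 : ∀ (g : P) (v w : G.graph.V), Relation.EqvGen R (ρ g v) (ρ g w) := by
    intro g v w
    induction hconn v w with
    | rel a b hab =>
      obtain ⟨e, hte, rfl, rfl⟩ := hab
      refine Relation.EqvGen.rel _ _ ⟨e, g, rfl, ?_⟩
      simp [ρ, hte]
    | refl a => exact Relation.EqvGen.refl _
    | symm a b _ ih => exact Relation.EqvGen.symm _ _ ih
    | trans a b c _ _ ih₁ ih₂ => exact Relation.EqvGen.trans _ _ _ ih₁ ih₂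
  -- `UghΠ_w = UgΠ_w` for `h ∈ Π_w`
  have hρ : ∀ (g h : P) (w : G.graph.V), h ∈ G.vertGp w → ρ (g * h) w = ρ g w := by
    intro g h w hh
    simp only [ρ, Sigma.mk.injEq, heq_eq_eq, true_and]
    exact (DoubleCoset.eq _ _ _ _).mpr ⟨1, U.one_mem, h⁻¹, (G.vertGp w).inv_mem hh, by group⟩
  intro x y
  rcases isEmpty_or_nonempty G.graph.V with hV | ⟨⟨v₀⟩⟩
  · exact (hV.false x.1).elim
  -- (2) closure induction over the generating set `(⋃_v Π_v) ∪ range t`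
  have step2 : ∀ g ∈ Subgroup.closure ((⋃ v, (G.vertGp v : Set P)) ∪ Set.range t), ∀ v,
      Relation.EqvGen R (ρ g v) (ρ 1 v₀) := by
    intro g hg
    refine Subgroup.closure_induction_right (p := fun g _ => ∀ v, Relation.EqvGen R (ρ g v) (ρ 1 v₀))
      (fun v => step1 1 v v₀) ?_ ?_ hg
    · rintro x _ y (hy | ⟨e, rfl⟩) ih v
      · -- `y ∈ Π_w`
        obtain ⟨w, hw⟩ := Set.mem_iUnion.mp hy
        exact Relation.EqvGen.trans _ _ _ (step1 (x * y) v w) ((hρ x y w hw) ▸ ih w)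
      · -- `y = t e`: the node `U x t_e Π_e` joins `U x t_e Π_{src e}` to `U x Π_{tgt e}`
        have hadj : Relation.EqvGen R (ρ (x * t e) (src e)) (ρ x (tgt e)) := by
          refine Relation.EqvGen.rel _ _ ⟨e, x * t e, rfl, ?_⟩
          simp [ρ]
        exact Relation.EqvGen.trans _ _ _ (step1 (x * t e) v (src e))
          (Relation.EqvGen.trans _ _ _ hadj (ih (tgt e)))
    · rintro x _ y (hy | ⟨e, rfl⟩) ih v
      · obtain ⟨w, hw⟩ := Set.mem_iUnion.mp hy
        exact Relation.EqvGen.trans _ _ _ (step1 (x * y⁻¹) v w)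
          ((hρ x y⁻¹ w ((G.vertGp w).inv_mem hw)) ▸ ih w)
      · -- `y = t e`: the node `U x Π_e` joins `U x Π_{src e}` to `U x t_e⁻¹ Π_{tgt e}`
        have hadj : Relation.EqvGen R (ρ x (src e)) (ρ (x * (t e)⁻¹) (tgt e)) :=
          Relation.EqvGen.rel _ _ ⟨e, x, rfl, rfl⟩
        exact Relation.EqvGen.trans _ _ _ (step1 (x * (t e)⁻¹) v (tgt e))
          (Relation.EqvGen.trans _ _ _ (Relation.EqvGen.symm _ _ hadj) (ih (src e)))
  -- (3) density: every coset `Ug` meets that subgroup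
  have step3 : ∀ g : P, ∃ d ∈ Subgroup.closure ((⋃ v, (G.vertGp v : Set P)) ∪ Set.range t),
      ∃ u ∈ U, d = u * g := by
    intro g
    have hD : Dense ((Subgroup.closure ((⋃ v, (G.vertGp v : Set P)) ∪ Set.range t) :
        Subgroup P) : Set P) := by
      rw [Subgroup.iSup_eq_closure, ← Subgroup.closure_union] at hgen
      have hc := congrArg SetLike.coe hgen
      rw [Subgroup.topologicalClosure_coe, Subgroup.coe_top] at hc
      exact dense_iff_closure_eq.mpr hc
    obtain ⟨d, hdO, hdD⟩ := hD.inter_open_nonempty {x | x * g⁻¹ ∈ (U : Set P)}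
      (hU.preimage (continuous_id.mul continuous_const)) ⟨g, by simp [U.one_mem]⟩
    exact ⟨d, hdD, d * g⁻¹, hdO, by group⟩
  -- (4) every vertex lies in the component of `UΠ_{v₀}`
  have step4 : ∀ z : (Σ v : G.graph.V, DoubleCoset.Quotient (U : Set P) (G.vertGp v : Set P)),
      Relation.EqvGen R z (ρ 1 v₀) := by
    rintro ⟨v, q⟩
    induction q using Quotient.inductionOn' with
    | h g =>
      obtain ⟨d, hd, u, hu, rfl⟩ := step3 g
      have h1 : (⟨v, Quotient.mk'' g⟩ : Σ v : G.graph.V,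
          DoubleCoset.Quotient (U : Set P) (G.vertGp v : Set P)) = ρ (u * g) v := by
        simp only [ρ, Sigma.mk.injEq, heq_eq_eq, true_and]
        exact (DoubleCoset.eq _ _ _ _).mpr ⟨u, hu, 1, (G.vertGp v).one_mem, by group⟩
      rw [h1]
      exact step2 _ hd v
  exact Relation.EqvGen.trans _ _ _ (step4 x) (Relation.EqvGen.symm _ _ (step4 y))

/-! ### The criterion with stable letters -/

/-- **[CombGC] Rmk. 1.1.3 / [IUTchI] Rmk. 1.2.3 (i) — `i(G_U) ≤ n(G_U) + 1` for arbitrary dual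
graphs.**  Let `G : PSCDatum Π`, `Π` compact.  Suppose the nodes are oriented by `src, tgt` with stable
letters `t : N → Π` such that `Π_e ≤ Π_{src e}` and `t_e Π_e t_e⁻¹ ≤ Π_{tgt e}` (Def. 1.1 (ii)'s
conjugates; `t_e = 1` along a spanning tree), the vertex set is connected along the nodes with
`t_e = 1`, and the `Π_v` together with the `t_e` topologically generate `Π` (the fundamental group of
the graph of groups).  Then every covering `G_U` (`U` open) has `i(G_U) ≤ n(G_U) + 1`:
`G.VertCountLeNodeCountSucc`. [cite: MochizukiCombGC2007, Rmk 1.1.3 p.8] -/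
theorem vertCountLeNodeCountSucc_of_generate_stable [CompactSpace P] (G : PSCDatum P)
    (src tgt : G.graph.N → G.graph.V) (t : G.graph.N → P)
    (hsrc : ∀ e, G.nodeGp e ≤ G.vertGp (src e))
    (htgt : ∀ e, ∀ p ∈ G.nodeGp e, t e * p * (t e)⁻¹ ∈ G.vertGp (tgt e))
    (hconn : ∀ v w : G.graph.V,
      Relation.EqvGen (fun a b => ∃ e, t e = 1 ∧ src e = a ∧ tgt e = b) v w)
    (hgen : ((⨆ v, G.vertGp v) ⊔ Subgroup.closure (Set.range t)).topologicalClosure = ⊤) :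
    G.VertCountLeNodeCountSucc := by
  classical
  intro U hU
  haveI : Finite (P ⧸ U) := Subgroup.quotient_finite_of_isOpen U hU
  haveI : U.FiniteIndex := Subgroup.finiteIndex_of_finite_quotient
  haveI : ∀ v, Finite (DoubleCoset.Quotient (U : Set P) (G.vertGp v : Set P)) := fun v =>
    PSCCounting.finite_doubleCoset_quotient U (G.vertGp v)
  haveI : ∀ e, Finite (DoubleCoset.Quotient (U : Set P) (G.nodeGp e : Set P)) := fun e =>
    PSCCounting.finite_doubleCoset_quotient U (G.nodeGp e)
  -- the incidence maps of the coset graph `𝒯_U`: `UgΠ_e ↦ UgΠ_{src e}`, `UgΠ_e ↦ U g t_e⁻¹ Π_{tgt e}`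
  have hwd : ∀ (e : G.graph.N) (a b : P), DoubleCoset.setoid (U : Set P) (G.nodeGp e : Set P) a b →
      DoubleCoset.setoid (U : Set P) (G.vertGp (tgt e) : Set P) (a * (t e)⁻¹) (b * (t e)⁻¹) := by
    intro e a b hab
    rw [DoubleCoset.rel_iff] at hab ⊢
    obtain ⟨x, hx, p, hp, rfl⟩ := hab
    exact ⟨x, hx, t e * p * (t e)⁻¹, htgt e p hp, by group⟩
  let s : (Σ e : G.graph.N, DoubleCoset.Quotient (U : Set P) (G.nodeGp e : Set P)) →
      (Σ v : G.graph.V, DoubleCoset.Quotient (U : Set P) (G.vertGp v : Set P)) := fun x =>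
    ⟨src x.1, Quotient.map' id (fun a b hab => doubleCoset_rel_mono_right (hsrc x.1) hab) x.2⟩
  let t' : (Σ e : G.graph.N, DoubleCoset.Quotient (U : Set P) (G.nodeGp e : Set P)) →
      (Σ v : G.graph.V, DoubleCoset.Quotient (U : Set P) (G.vertGp v : Set P)) := fun x =>
    ⟨tgt x.1, Quotient.map' (fun a => a * (t x.1)⁻¹) (fun a b hab => hwd x.1 a b hab) x.2⟩
  have hst : ∀ x y, Relation.EqvGen (fun a b => ∃ ε, s ε = a ∧ t' ε = b) x y := by
    intro x y
    refine Relation.EqvGen.mono (fun a b hab => ?_) x y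
      (eqvGen_doubleCoset_of_generate_stable G src tgt t hconn hgen U hU x y)
    obtain ⟨e, g, rfl, rfl⟩ := hab
    exact ⟨⟨e, DoubleCoset.mk U (G.nodeGp e) g⟩, rfl, rfl⟩
  have hle := PSCCounting.natCard_le_natCard_add_one_of_eqvGen s t' hst
  rw [Nat.card_sigma, Nat.card_sigma] at hle
  exact hle

/-! ### One-vertex data with self-nodes (irreducible nodal curves) -/

/-- **One-vertex data with self-nodes**: one vertex `v₀`, every node a self-node at `v₀` with
`Π_e ≤ Π_{v₀}` and `t_e Π_e t_e⁻¹ ≤ Π_{v₀}` for stable letters `t_e`, and `Π_{v₀}` together with the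
`t_e` topologically generating `Π` (compact) — the shape of an IRREDUCIBLE NODAL curve, where
`Π_{v₀} ≠ Π_G` and the coverings have many vertices.  Then `i(G_U) ≤ n(G_U) + 1` for every open `U`.
[cite: MochizukiCombGC2007, Rmk 1.1.3 p.8] -/
theorem vertCountLeNodeCountSucc_of_oneVertex_stable [CompactSpace P] (G : PSCDatum P)
    (v₀ : G.graph.V) (hV : ∀ w, w = v₀) (t : G.graph.N → P)
    (hN : ∀ e, G.nodeGp e ≤ G.vertGp v₀)
    (hNt : ∀ e, ∀ p ∈ G.nodeGp e, t e * p * (t e)⁻¹ ∈ G.vertGp v₀)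
    (hgen : (G.vertGp v₀ ⊔ Subgroup.closure (Set.range t)).topologicalClosure = ⊤) :
    G.VertCountLeNodeCountSucc := by
  refine vertCountLeNodeCountSucc_of_generate_stable G (fun _ => v₀) (fun _ => v₀) t hN hNt ?_ ?_
  · intro v w
    rw [hV v, hV w]
    exact Relation.EqvGen.refl _
  · rw [eq_top_iff, ← hgen]
    exact Subgroup.topologicalClosure_mono
      (sup_le_sup_right (le_iSup (fun v => G.vertGp v) v₀) _)

end PSCDatum

end Literature.AnabelianGeometry.SemiGraphs

end
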